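import Literature.MathematicalPhysics.QuantumFieldTheory.CurvatureGaussianField
import Literature.Probability.LatticeModels.LatticeGreenAsymptotics
import HarnessLib

/-!
# Stub `stub_lineVariance` of line `Sketch` (crux `stmt-QuantumFields-8760`)

Route `EquipartitionCriticality` of `YangMills`, crux item `stmt-QuantumFields-8760`
(`Summit.QuantumFields.YangMills.Theses.EquipartitionCriticality.EquipartitionPinsProbe`), line
`Sketch`, STUB "line variance" of the lead's skeleton.

What is proved: for every coordinate plane `(i, j)`, `i < j`, of `ℤ⁴`, the Gaussian variance of the
line average `h_L = L⁻¹ ∑_{t<L} δ_{(t e₀; i, j)}` of a plaquette indicator along the `e₀` axis,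
`Q(h_L) = L⁻² ∑_{s,t<L} T((s e₀; i, j), (t e₀; i, j))` with `T = curvatureTwoPoint`, tends to `0`
as `L → ∞`.

Proof: by stationarity (`curvatureTwoPoint_shift`), `T((s e₀; i,j), (t e₀; i,j)) = c (t - s)` with
`c n = T((0; i,j), (n e₀; i,j))` (`LineVariance.curvatureTwoPoint_single_single`); by the decay of
the kernel in its second slot (re-derived inside
`LineVariance.tendsto_curvatureTwoPoint_single_cofinite` from the tree's `latticeGreen_asymptotics`,
exactly as in the landed stub `stub_kernelDecay`, whose module is deliberately not imported so that
this file does not depend on the build order of today's modules) and injectivity of `n ↦ n e₀`,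
`c n → 0` along the cofinite filter of `ℤ`. CESÀRO
(`LineVariance.tendsto_double_sum_div_sq`): for `s < L`,
`∑_{t<L} |c (t - s)| ≤ ∑_{n<L} |c n| + ∑_{n<L} |c (-(n+1))|` (split at `t = s`, reindex,
`LineVariance.sum_abs_sub_le`), so `|L⁻² ∑_{s,t<L} c(t-s)| ≤ L⁻¹ ∑_{n<L} |c n| + L⁻¹ ∑_{n<L} |c(-(n+1))|`
(`LineVariance.abs_double_sum_div_sq_le`), and both Cesàro means tend to `0`
(`Filter.Tendsto.cesaro`) because `|c n| → 0` and `|c (-(n+1))| → 0` as `n → ∞` in `ℕ`.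
-/

noncomputable section

open Filter
open scoped Topology Real

open Literature.MathematicalPhysics.QuantumFieldTheory Literature.MathematicalPhysics.QuantumLattice
  Literature.Probability.LatticeModels

namespace Summit.QuantumFields.YangMills.Theorems.EquipartitionPinsProbe

namespace LineVariance

/-- Reindexing bound: for `s < L` and any `c : ℤ → ℝ`,
`∑_{t<L} |c (t - s)| ≤ ∑_{n<L} |c n| + ∑_{n<L} |c (-(n+1))|` (split the sum at `t = s`; the part
`t ≥ s` is `∑_{m < L-s} |c m|`, the part `t < s` is `∑_{m < s} |c (-(m+1))|`). -/
theorem sum_abs_sub_le (c : ℤ → ℝ) {s L : ℕ} (hs : s < L) :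
    ∑ t ∈ Finset.range L, |c ((t : ℤ) - s)| ≤
      ∑ n ∈ Finset.range L, |c n| + ∑ n ∈ Finset.range L, |c (-((n : ℤ) + 1))| := by
  have h1 : ∑ t ∈ Finset.Ico s L, |c ((t : ℤ) - s)| ≤ ∑ n ∈ Finset.range L, |c n| := by
    rw [Finset.sum_Ico_eq_sum_range]
    calc ∑ k ∈ Finset.range (L - s), |c (((s + k : ℕ) : ℤ) - s)|
        = ∑ k ∈ Finset.range (L - s), |c k| := by
          refine Finset.sum_congr rfl fun k _ => ?_
          congr 2
          push_cast
          ring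
      _ ≤ ∑ n ∈ Finset.range L, |c n| :=
          Finset.sum_le_sum_of_subset_of_nonneg (Finset.range_subset_range.2 (Nat.sub_le L s))
            fun _ _ _ => abs_nonneg _
  have h2 : ∑ t ∈ Finset.range s, |c ((t : ℤ) - s)| ≤
      ∑ n ∈ Finset.range L, |c (-((n : ℤ) + 1))| := by
    calc ∑ t ∈ Finset.range s, |c ((t : ℤ) - s)|
        = ∑ j ∈ Finset.range s, |c (((s - 1 - j : ℕ) : ℤ) - s)| :=
          (Finset.sum_range_reflect (fun t : ℕ => |c ((t : ℤ) - s)|) s).symm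
      _ = ∑ j ∈ Finset.range s, |c (-((j : ℤ) + 1))| := by
          refine Finset.sum_congr rfl fun j hj => ?_
          rw [Finset.mem_range] at hj
          congr 2
          omega
      _ ≤ ∑ n ∈ Finset.range L, |c (-((n : ℤ) + 1))| :=
          Finset.sum_le_sum_of_subset_of_nonneg (Finset.range_subset_range.2 hs.le)
            fun _ _ _ => abs_nonneg _
  calc ∑ t ∈ Finset.range L, |c ((t : ℤ) - s)|
      = ∑ t ∈ Finset.range s, |c ((t : ℤ) - s)| + ∑ t ∈ Finset.Ico s L, |c ((t : ℤ) - s)| :=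
        (Finset.sum_range_add_sum_Ico _ hs.le).symm
    _ ≤ ∑ n ∈ Finset.range L, |c n| + ∑ n ∈ Finset.range L, |c (-((n : ℤ) + 1))| := by
        linarith

/-- Pointwise bound behind the Cesàro argument: for every `L` and any `c : ℤ → ℝ`,
`|L⁻² ∑_{s,t<L} c (t - s)| ≤ L⁻¹ ∑_{n<L} |c n| + L⁻¹ ∑_{n<L} |c (-(n+1))|`. -/
theorem abs_double_sum_div_sq_le (c : ℤ → ℝ) (L : ℕ) :
    |(∑ s ∈ Finset.range L, ∑ t ∈ Finset.range L, c ((t : ℤ) - s)) / ((L : ℝ) ^ 2)| ≤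
      (L : ℝ)⁻¹ * ∑ n ∈ Finset.range L, |c n| +
        (L : ℝ)⁻¹ * ∑ n ∈ Finset.range L, |c (-((n : ℤ) + 1))| := by
  rcases Nat.eq_zero_or_pos L with rfl | hL
  · simp
  have hL' : (L : ℝ) ≠ 0 := Nat.cast_ne_zero.2 hL.ne'
  set A := ∑ n ∈ Finset.range L, |c n|
  set B := ∑ n ∈ Finset.range L, |c (-((n : ℤ) + 1))|
  have hbound : |∑ s ∈ Finset.range L, ∑ t ∈ Finset.range L, c ((t : ℤ) - s)| ≤ L * (A + B) := by
    calc |∑ s ∈ Finset.range L, ∑ t ∈ Finset.range L, c ((t : ℤ) - s)|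
        ≤ ∑ s ∈ Finset.range L, |∑ t ∈ Finset.range L, c ((t : ℤ) - s)| :=
          Finset.abs_sum_le_sum_abs _ _
      _ ≤ ∑ s ∈ Finset.range L, ∑ t ∈ Finset.range L, |c ((t : ℤ) - s)| :=
          Finset.sum_le_sum fun s _ => Finset.abs_sum_le_sum_abs _ _
      _ ≤ ∑ s ∈ Finset.range L, (A + B) :=
          Finset.sum_le_sum fun s hs => sum_abs_sub_le c (Finset.mem_range.1 hs)
      _ = L * (A + B) := by
          rw [Finset.sum_const, Finset.card_range, nsmul_eq_mul]
  calc |(∑ s ∈ Finset.range L, ∑ t ∈ Finset.range L, c ((t : ℤ) - s)) / ((L : ℝ) ^ 2)|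
      = |∑ s ∈ Finset.range L, ∑ t ∈ Finset.range L, c ((t : ℤ) - s)| / ((L : ℝ) ^ 2) := by
        rw [abs_div, abs_of_nonneg (by positivity : (0 : ℝ) ≤ (L : ℝ) ^ 2)]
    _ ≤ L * (A + B) / ((L : ℝ) ^ 2) := div_le_div_of_nonneg_right hbound (by positivity)
    _ = (L : ℝ)⁻¹ * A + (L : ℝ)⁻¹ * B := by
        rw [sq, mul_div_mul_left _ _ hL', div_eq_inv_mul, mul_add]

/-- **Cesàro lemma**: if `c : ℤ → ℝ` tends to `0` at infinity (cofinite filter), then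
`L⁻² ∑_{s,t<L} c (t - s) → 0` as `L → ∞`. -/
theorem tendsto_double_sum_div_sq (c : ℤ → ℝ) (hc : Tendsto c cofinite (𝓝 0)) :
    Tendsto (fun L : ℕ => (∑ s ∈ Finset.range L, ∑ t ∈ Finset.range L, c ((t : ℤ) - s)) /
      ((L : ℝ) ^ 2)) atTop (𝓝 0) := by
  have hA : Tendsto (fun n : ℕ => |c n|) atTop (𝓝 0) := by
    have h := hc.comp (Nat.cast_injective (R := ℤ)).tendsto_cofinite
    rw [Nat.cofinite_eq_atTop] at h
    simpa using h.abs
  have hB : Tendsto (fun n : ℕ => |c (-((n : ℤ) + 1))|) atTop (𝓝 0) := by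
    have hinj : Function.Injective (fun n : ℕ => -((n : ℤ) + 1)) := by
      intro a b h
      simp only [neg_inj, add_left_inj, Nat.cast_inj] at h
      exact h
    have h := hc.comp hinj.tendsto_cofinite
    rw [Nat.cofinite_eq_atTop] at h
    simpa using h.abs
  have hlim := hA.cesaro.add hB.cesaro
  rw [add_zero] at hlim
  refine squeeze_zero_norm (fun L => ?_) hlim
  rw [Real.norm_eq_abs]
  exact abs_double_sum_div_sq_le c L

/-- Stationarity along the `e₀` axis: `T((s e₀; i,j), (t e₀; i,j)) = T((0; i,j), ((t - s) e₀; i,j))`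
(`curvatureTwoPoint_shift` with the shift `s e₀`, `Pi.single_add`). -/
theorem curvatureTwoPoint_single_single (pl : {p : Fin 4 × Fin 4 // p.1 < p.2}) (s t : ℤ) :
    curvatureTwoPoint ((Pi.single (0 : Fin 4) s : Site 4), pl) ((Pi.single (0 : Fin 4) t : Site 4), pl) =
      curvatureTwoPoint ((0 : Site 4), pl) ((Pi.single (0 : Fin 4) (t - s) : Site 4), pl) := by
  have h := curvatureTwoPoint_shift ((0 : Site 4), pl) ((Pi.single (0 : Fin 4) (t - s) : Site 4), pl)
    (Pi.single (0 : Fin 4) s)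
  rw [← h]
  simp only [zero_add, ← Pi.single_add, sub_add_cancel]

/-- Decay of the axial two-point numbers: `c n = T((0; i,j), (n e₀; i,j)) → 0` as `|n| → ∞`
(cofinite filter of `ℤ`). The kernel decays in its second slot, `T(p, (x_q + v; q)) → 0` as `v → ∞`
in `ℤ^d`, `d ≥ 3` (it is a signed sum of sixteen shifted edge Green functions `[dirs equal] G₀(c - v)`
with `G₀ = latticeGreen / 2 → 0` at infinity by `latticeGreen_asymptotics`; this is the content of
the landed stub `stub_kernelDecay`, re-derived here in `have` form); compose with the injective map
`n ↦ n e₀ = Pi.single 0 n` at `d = 4`. -/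
theorem tendsto_curvatureTwoPoint_single_cofinite (pl : {p : Fin 4 × Fin 4 // p.1 < p.2}) :
    Tendsto (fun n : ℤ =>
      curvatureTwoPoint ((0 : Site 4), pl) ((Pi.single (0 : Fin 4) n : Site 4), pl)) cofinite (𝓝 0) := by
  -- sub-level sets of the squared norm are finite, so `|x| → ∞` along the cofinite filter of `ℤ^d`
  have hfin : ∀ {d : ℕ} (R : ℝ), {x : Site d | ∑ i, ((x i : ℤ) : ℝ) ^ 2 < R}.Finite := by
    intro d R
    obtain ⟨N, hN⟩ := exists_nat_ge R
    refine (Set.Finite.pi (t := fun _ : Fin d => Set.Icc (-(N : ℤ)) N)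
      fun _ => Set.finite_Icc _ _).subset ?_
    intro x hx
    simp only [Set.mem_setOf_eq] at hx
    simp only [Set.mem_pi, Set.mem_univ, true_implies, Set.mem_Icc]
    intro i
    have h1 : ((x i : ℤ) : ℝ) ^ 2 ≤ ∑ j, ((x j : ℤ) : ℝ) ^ 2 :=
      Finset.single_le_sum (f := fun j => ((x j : ℤ) : ℝ) ^ 2) (fun j _ => sq_nonneg _)
        (Finset.mem_univ i)
    have h2 : ((x i : ℤ) : ℝ) ^ 2 < N := by linarith
    have h3 : (x i) ^ 2 < N := by exact_mod_cast h2
    have ha : x i ≤ (x i) ^ 2 := Int.le_self_sq (x i)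
    have hb : -(x i) ≤ (x i) ^ 2 := by
      have := Int.le_self_sq (-(x i))
      rwa [neg_sq] at this
    constructor <;> linarith
  have hsqrt : ∀ {d : ℕ},
      Tendsto (fun x : Site d => Real.sqrt (∑ i, ((x i : ℤ) : ℝ) ^ 2)) cofinite atTop := by
    intro d
    refine Real.tendsto_sqrt_atTop.comp (tendsto_atTop.2 fun R => ?_)
    simp only [Filter.eventually_cofinite, not_le]
    exact hfin R
  -- decay of the lattice Green function (`d ≥ 3`) from `latticeGreen_asymptotics`
  have hG : ∀ {d : ℕ}, 3 ≤ d → Tendsto (latticeGreen : Site d → ℝ) cofinite (𝓝 0) := by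
    intro d hd
    obtain ⟨K, hK⟩ := latticeGreen_asymptotics hd
    set A : ℝ := Real.Gamma ((d : ℝ) / 2 - 1) / (2 * π ^ ((d : ℝ) / 2))
    have hd' : (3 : ℝ) ≤ d := by exact_mod_cast hd
    have h1 : Tendsto (fun x : Site d => Real.sqrt (∑ i, ((x i : ℤ) : ℝ) ^ 2) ^ (2 - (d : ℝ)))
        cofinite (𝓝 0) := by
      have := (tendsto_rpow_neg_atTop (y := (d : ℝ) - 2) (by linarith)).comp (hsqrt (d := d))
      refine this.congr fun x => ?_
      simp only [Function.comp_apply, neg_sub]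
    have h2 : Tendsto (fun x : Site d => Real.sqrt (∑ i, ((x i : ℤ) : ℝ) ^ 2) ^ (-(d : ℝ)))
        cofinite (𝓝 0) :=
      (tendsto_rpow_neg_atTop (y := (d : ℝ)) (by linarith)).comp hsqrt
    have hbound : ∀ᶠ x : Site d in cofinite,
        ‖latticeGreen x‖ ≤ |A| * Real.sqrt (∑ i, ((x i : ℤ) : ℝ) ^ 2) ^ (2 - (d : ℝ)) +
          |K| * Real.sqrt (∑ i, ((x i : ℤ) : ℝ) ^ 2) ^ (-(d : ℝ)) := by
      filter_upwards [eventually_cofinite_ne (0 : Site d)] with x hx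
      have hKx := hK x hx
      set r : ℝ := Real.sqrt (∑ i, ((x i : ℤ) : ℝ) ^ 2) with hr
      have hr0 : 0 ≤ r := Real.sqrt_nonneg _
      have hp1 : 0 ≤ r ^ (2 - (d : ℝ)) := Real.rpow_nonneg hr0 _
      have hp2 : 0 ≤ r ^ (-(d : ℝ)) := Real.rpow_nonneg hr0 _
      rw [Real.norm_eq_abs]
      calc |latticeGreen x|
          = |(latticeGreen x - A * r ^ (2 - (d : ℝ))) + A * r ^ (2 - (d : ℝ))| := by
            rw [sub_add_cancel]
        _ ≤ |latticeGreen x - A * r ^ (2 - (d : ℝ))| + |A * r ^ (2 - (d : ℝ))| := abs_add_le _ _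
        _ ≤ K * r ^ (-(d : ℝ)) + |A| * r ^ (2 - (d : ℝ)) := by
            exact add_le_add hKx (by rw [abs_mul, abs_of_nonneg hp1])
        _ ≤ |A| * r ^ (2 - (d : ℝ)) + |K| * r ^ (-(d : ℝ)) := by
            nlinarith [le_abs_self K]
    refine squeeze_zero_norm' hbound ?_
    simpa using (h1.const_mul |A|).add (h2.const_mul |K|)
  -- decay of the edge Green kernel in its second slot
  have hE : ∀ {d : ℕ}, 3 ≤ d → ∀ e f : ZdEdge d,
      Tendsto (fun v : Site d => edgeGreen e (f.1 + v, f.2)) cofinite (𝓝 0) := by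
    intro d hd e f
    by_cases h : e.2 = f.2
    · simp only [edgeGreen_apply, h, if_true]
      have := ((hG hd).comp (sub_right_injective :
        Function.Injective fun v : Site d => (e.1 - f.1) - v).tendsto_cofinite).div_const 2
      rw [zero_div] at this
      refine this.congr fun v => ?_
      simp only [Function.comp_apply, sub_sub]
    · simp only [edgeGreen_apply, h, if_false]
      exact tendsto_const_nhds
  -- translating a plaquette translates its boundary edges
  have hB : ∀ {d : ℕ} (q : ZdPlaquette d) (v : Site d) (b : Fin 4),
      plaquetteBoundary (q.1 + v, q.2) b =
        ((plaquetteBoundary q b).1 + v, (plaquetteBoundary q b).2) := by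
    intro d q v b
    fin_cases b <;> simp [plaquetteBoundary, add_right_comm _ v]
  -- decay of the two-plaquette kernel in its second slot
  have hT : ∀ {d : ℕ}, 3 ≤ d → ∀ p q : ZdPlaquette d,
      Tendsto (fun v : Site d => curvatureTwoPoint p (q.1 + v, q.2)) cofinite (𝓝 0) := by
    intro d hd p q
    have h : ∀ a b : Fin 4, Tendsto (fun v : Site d =>
        plaquetteBoundarySign a * plaquetteBoundarySign b *
          edgeGreen (plaquetteBoundary p a) (plaquetteBoundary (q.1 + v, q.2) b)) cofinite (𝓝 0) := by
      intro a b
      have := (hE hd (plaquetteBoundary p a) (plaquetteBoundary q b)).const_mul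
        (plaquetteBoundarySign a * plaquetteBoundarySign b)
      rw [mul_zero] at this
      refine this.congr fun v => ?_
      rw [hB]
    have hsum := tendsto_finsetSum Finset.univ
      fun a _ => tendsto_finsetSum Finset.univ fun b _ => h a b
    simpa [curvatureTwoPoint] using hsum
  -- `d = 4`, along the axis `n ↦ n e₀`
  have h := (hT (by norm_num) ((0 : Site 4), pl) ((0 : Site 4), pl)).comp
    (Pi.single_injective (M := fun _ : Fin 4 => ℤ) (0 : Fin 4)).tendsto_cofinite
  refine h.congr fun n => ?_
  simp only [Function.comp_apply, zero_add]

end LineVariance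

/-- STUB "line variance" — **the Gaussian variance of a line average vanishes**: for every
coordinate plane `(i, j)`, `i < j`, of `ℤ⁴`,
`L⁻² ∑_{s,t<L} curvatureTwoPoint ((s e₀; i,j)) ((t e₀; i,j)) → 0` as `L → ∞`; by stationarity the
summand is `c (t - s)` with `c n = curvatureTwoPoint (0; i,j) (n e₀; i,j) → 0` at infinity (kernel
decay, as in `stub_kernelDecay`), and a double Cesàro mean of a null sequence is null. -/
theorem stub_lineVariance :
    ∀ (i j : Fin 4) (hij : i < j),
      Filter.Tendsto (fun L : ℕ =>
          (∑ s ∈ Finset.range L, ∑ t ∈ Finset.range L,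
            Literature.MathematicalPhysics.QuantumFieldTheory.curvatureTwoPoint
              ((Pi.single (0 : Fin 4) (s : ℤ) : Literature.Probability.LatticeModels.Site 4), ⟨(i, j), hij⟩)
              ((Pi.single (0 : Fin 4) (t : ℤ) : Literature.Probability.LatticeModels.Site 4), ⟨(i, j), hij⟩)) /
            ((L : ℝ) ^ 2))
        Filter.atTop (nhds 0) := by
  intro i j hij
  have h := LineVariance.tendsto_double_sum_div_sq _
    (LineVariance.tendsto_curvatureTwoPoint_single_cofinite ⟨(i, j), hij⟩)
  simp only [LineVariance.curvatureTwoPoint_single_single]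
  exact h

end Summit.QuantumFields.YangMills.Theorems.EquipartitionPinsProbe

end
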